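import Summits.Ventures.LatticeQCDFlow.Exactness.IMHCouplingBurnInDiagnostic
import HarnessLib

/-!
# A certified stopping rule for burn-in: the between-pair error bar of the coupling diagnostic is exact in expectation, so the
# remaining burn-in bias `β_k` of a flow-MCMC run lies within `s` of the measured `S̄` except with probability
# `(E[SE²] + ((1 − A)^{k+N}(c − a))²)/s²`

HONEST FRAMING: exact (Metropolis-corrected) sampling algorithms for lattice gauge theory;
figures of merit are autocorrelation/cost numbers at stated couplings and volumes; no
continuum-physics claim.

Venture `LatticeQCDFlow` (cell pub-lqcd), topic `Exactness`; FANOUT row 30 (lean-1, GEN-38).  NEW WORK of the cell,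
general state space; sequel to GEN-37's `Exactness/IMHCouplingBurnInDiagnostic` (D1: on the lag-one common-random-numbers pair
chain of `K = indepMH q w`, the summed corrections `S = Σ_{n<N}(f(X′_{k+n}) − f(Y_{k+n}))` measure the remaining burn-in bias
`β_k = π f − E f(Y_k)` of the plain run: `|E S − β_k| ≤ r^{k+N}(c − a)`, `E(S − β_k)² ≤ r^k(c − a)²W(2W − 1) + (r^{k+N}(c − a))²`,
`W = w(x₀)`, `r = 1 − 1/W`; «NOT CLAIMED: a stopping rule») and to row 11's `Scoring/ReplicaError` (`replicaMean`, `replicaSEsq`: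
the between-replica squared standard error is unbiased for the variance of the replica mean under equal means).  A seat that
runs `R` coupled pairs prints `S̄ ± SE`; this file certifies what that print means.

* §1 (any measurable space, any bounded measurable statistic `φ`, `R ≥ 2` pairwise independent replicas with a COMMON law `P`)
  **`replicas_stat_integral_SEsq_eq`** — `E[SE²] = Var(φ̄)` EXACTLY; **`replicas_stat_sq_eq_SEsq_add`** — `E(φ̄ − m)² = E[SE²] +
  (E_P φ − m)²` EXACTLY for every target `m`; **`replicas_stat_chebyshev`** — `P(|φ̄ − m| ≥ s) ≤ (E[SE²] + (E_P φ − m)²)/s²`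
  [bookkeeping on row 11's algebra, stated once for every replicated statistic of the cell].
* §2 (the diagnostic) **`crnLag_correction_replicas_mse_sub_SEsq_mem_Icc`** — `R ≥ 2` pairwise independent pairs from ONE initial
  coupling one update ahead: `E(S̄ − β_k)² − E[SE²] ∈ [0, (r^{k+N}(c − a))²]` — THE PRINTED ERROR BAR OF THE BIAS MEASUREMENT IS
  EXACT UP TO THE SQUARED TRUNCATION TERM; **`crnLag_correction_replicas_integral_SEsq_le`** — `E[SE²] ≤ [r^k(c − a)²W(2W − 1) +
  (r^{k+N}(c − a))²]/R`: it vanishes geometrically in the lag `k` and like `1/R`; **`crnLag_correction_replicas_chebyshev`** — THE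
  STOPPING RULE: `P(|S̄ − β_k| ≥ s) ≤ (E[SE²] + (r^{k+N}(c − a))²)/s²`, i.e. the unknown burn-in bias `β_k` of the sampler at time
  `k` lies in `[S̄ − s, S̄ + s]` except with that probability — a burn-in length `k` is ACCEPTED when `|S̄| + s` is below the
  tolerance, with a stated confidence and no reference value.
Reading (gauge files): to decide how many updates of the exact gauge sampler to discard, run `R` coupled pairs, print the mean
summed correction and its between-pair error; the true remaining bias is within `s` of the print with probability at least
`1 − (E[SE²] + ((1 − A)^{k+N}(c − a))²)/s²`, and the error bar itself is `O((1 − A)^k/R)`.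
NOT CLAIMED: a sequential (data-dependent `k`) rule and its optional-stopping analysis; coverage beyond Chebyshev; the sampling
law of `SE²`; any value of `A`.  No `sorry`, no new definitions, nothing cited as a fact.
-/

noncomputable section

namespace Summit.Ventures.LatticeQCDFlow.Exactness

open MeasureTheory ProbabilityTheory Function Finset
open scoped ENNReal unitInterval
open Summit.Ventures.LatticeQCDFlow.Scoring

variable {Ω : Type*} [MeasurableSpace Ω] {q : Measure Ω} [IsProbabilityMeasure q] {w : Ω → ℝ}

section Replicas

variable {Ω' : Type*} {mΩ' : MeasurableSpace Ω'} {μ : Measure Ω'} [IsProbabilityMeasure μ] {R : ℕ}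

/-! ## §1 Any replicated bounded statistic with a common law: the printed error bar is exact in expectation -/

section AnyStatistic

variable {S : Type*} [MeasurableSpace S] {Z : ℕ → Ω' → S} {φ : S → ℝ}

omit [IsProbabilityMeasure μ] in
/-- A bounded measurable statistic of a replica is square integrable. [ours, bookkeeping] -/
theorem memLp_stat_replica [IsFiniteMeasure μ] (hφ : Measurable φ) {B : ℝ} (hB : ∀ x, |φ x| ≤ B)
    (hZm : ∀ j, Measurable (Z j)) (j : ℕ) : MemLp (fun ω => φ (Z j ω)) 2 μ :=
  MemLp.of_bound ((hφ.comp (hZm j)).aestronglyMeasurable) B (ae_of_all _ fun ω => by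
    rw [Real.norm_eq_abs]; exact hB _)

/-- **`E[SE²] = Var(φ̄)` EXACTLY** for `R ≥ 2` pairwise independent replicas `Z_j` with a common law `P` and a bounded measurable
statistic `φ`. [ours, on row 11's `integral_replicaSEsq_of_means_eq`] -/
theorem replicas_stat_integral_SEsq_eq (hR : 2 ≤ R) (hφ : Measurable φ) {B : ℝ} (hB : ∀ x, |φ x| ≤ B)
    (hZm : ∀ j, Measurable (Z j)) {P : Measure S} (hlaw : ∀ j < R, μ.map (Z j) = P)
    (hind : ∀ i < R, ∀ j < R, i ≠ j → IndepFun (Z i) (Z j) μ) :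
    μ[replicaSEsq (fun j ω => φ (Z j ω)) R] = Var[replicaMean (fun j ω => φ (Z j ω)) R; μ] := by
  have hY2 : ∀ j < R, MemLp (fun ω => φ (Z j ω)) 2 μ := fun j _ => memLp_stat_replica hφ hB hZm j
  have hcov : ∀ i < R, ∀ j < R, i ≠ j → cov[fun ω => φ (Z i ω), fun ω => φ (Z j ω); μ] = 0 :=
    fun i hi j hj hij => ((hind i hi j hj hij).comp hφ hφ).covariance_eq_zero (hY2 i hi) (hY2 j hj)
  have hmean : ∀ j < R, μ[fun ω => φ (Z j ω)] = ∫ x, φ x ∂P := fun j hj => by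
    rw [← hlaw j hj, integral_map (hZm j).aemeasurable hφ.aestronglyMeasurable]
  exact integral_replicaSEsq_of_means_eq hR hY2 hcov hmean

/-- **`E(φ̄ − m)² = E[SE²] + (E_P φ − m)²` EXACTLY** for every target `m`, in the setting of `replicas_stat_integral_SEsq_eq`. [ours] -/
theorem replicas_stat_sq_eq_SEsq_add (hR : 2 ≤ R) (hφ : Measurable φ) {B : ℝ} (hB : ∀ x, |φ x| ≤ B)
    (hZm : ∀ j, Measurable (Z j)) {P : Measure S} (hlaw : ∀ j < R, μ.map (Z j) = P)
    (hind : ∀ i < R, ∀ j < R, i ≠ j → IndepFun (Z i) (Z j) μ) (m : ℝ) :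
    ∫ ω, (replicaMean (fun j ω => φ (Z j ω)) R ω - m) ^ 2 ∂μ =
      μ[replicaSEsq (fun j ω => φ (Z j ω)) R] + (∫ x, φ x ∂P - m) ^ 2 := by
  have hR0 : R ≠ 0 := by omega
  have hRne : (R : ℝ) ≠ 0 := by exact_mod_cast hR0
  have hY2 : ∀ j < R, MemLp (fun ω => φ (Z j ω)) 2 μ := fun j _ => memLp_stat_replica hφ hB hZm j
  have hmean : ∀ j < R, μ[fun ω => φ (Z j ω)] = ∫ x, φ x ∂P := fun j hj => by
    rw [← hlaw j hj, integral_map (hZm j).aemeasurable hφ.aestronglyMeasurable]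
  have hbar : μ[replicaMean (fun j ω => φ (Z j ω)) R] = ∫ x, φ x ∂P := by
    rw [integral_replicaMean hY2, Finset.sum_congr rfl fun j hj => hmean j (mem_range.1 hj), sum_const, card_range,
      nsmul_eq_mul, mul_div_cancel_left₀ _ hRne]
  rw [integral_sub_const_sq (memLp_replicaMean hY2) m, hbar, replicas_stat_integral_SEsq_eq hR hφ hB hZm hlaw hind]

/-- **CHEBYSHEV WITH THE PRINTED ERROR BAR**: `P(|φ̄ − m| ≥ s) ≤ (E[SE²] + (E_P φ − m)²)/s²` for `s > 0`. [ours] -/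
theorem replicas_stat_chebyshev (hR : 2 ≤ R) (hφ : Measurable φ) {B : ℝ} (hB : ∀ x, |φ x| ≤ B)
    (hZm : ∀ j, Measurable (Z j)) {P : Measure S} (hlaw : ∀ j < R, μ.map (Z j) = P)
    (hind : ∀ i < R, ∀ j < R, i ≠ j → IndepFun (Z i) (Z j) μ) (m : ℝ) {s : ℝ} (hs : 0 < s) :
    μ.real {ω | s ≤ |replicaMean (fun j ω => φ (Z j ω)) R ω - m|} ≤
      (μ[replicaSEsq (fun j ω => φ (Z j ω)) R] + (∫ x, φ x ∂P - m) ^ 2) / s ^ 2 := by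
  have hY2 : ∀ j < R, MemLp (fun ω => φ (Z j ω)) 2 μ := fun j _ => memLp_stat_replica hφ hB hZm j
  rw [← replicas_stat_sq_eq_SEsq_add hR hφ hB hZm hlaw hind m]
  exact measureReal_abs_sub_ge_le (memLp_replicaMean hY2) m hs

end AnyStatistic

/-! ## §2 The coupling diagnostic: a certified stopping rule for burn-in -/

variable {Z : ℕ → Ω' → (ℕ → Ω × Ω)} (ν : Measure (Ω × Ω)) [IsProbabilityMeasure ν]

omit [IsProbabilityMeasure q] in
/-- The summed corrections are a measurable statistic of the pair path. [ours, bookkeeping] -/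
theorem measurable_crnCorrectionSum {f : Ω → ℝ} (hf : Measurable f) (k N : ℕ) :
    Measurable fun z : ℕ → Ω × Ω => ∑ n ∈ range N, (f ((z (k + n)).1) - f ((z (k + n)).2)) :=
  Finset.measurable_sum _ fun n _ =>
    (hf.comp (measurable_fst.comp (measurable_pi_apply (k + n)))).sub
      (hf.comp (measurable_snd.comp (measurable_pi_apply (k + n))))

omit [MeasurableSpace Ω] [IsProbabilityMeasure q] in
/-- `|Σ_{n<N} D_{k+n}| ≤ N(c − a)` for `a ≤ f ≤ c`. [ours, bookkeeping] -/
theorem abs_crnCorrectionSum_le {f : Ω → ℝ} {a c : ℝ} (ha : ∀ x, a ≤ f x) (hc : ∀ x, f x ≤ c) (k N : ℕ)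
    (z : ℕ → Ω × Ω) : |∑ n ∈ range N, (f ((z (k + n)).1) - f ((z (k + n)).2))| ≤ N * (c - a) := by
  refine (abs_sum_le_sum_abs _ _).trans ?_
  calc ∑ n ∈ range N, |f ((z (k + n)).1) - f ((z (k + n)).2)| ≤ ∑ n ∈ range N, (c - a) :=
        sum_le_sum fun n _ => by
          have h1 := ha ((z (k + n)).1); have h2 := hc ((z (k + n)).1)
          have h3 := ha ((z (k + n)).2); have h4 := hc ((z (k + n)).2)
          exact abs_le.2 ⟨by linarith, by linarith⟩
    _ = N * (c - a) := by rw [sum_const, card_range, nsmul_eq_mul]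

/-- **THE PRINTED ERROR BAR OF THE BIAS MEASUREMENT IS EXACT UP TO THE SQUARED TRUNCATION TERM.**  `w` measurable (a `Fact`), positive,
normalised, maximal at `x₀` (`r = 1 − 1/w(x₀)`); `K̂` a CRN pair kernel; `R ≥ 2` pairwise independent pair streams, each distributed as
the pair chain from ONE initial coupling `ν̂` one update ahead in its first coordinate; `a ≤ f ≤ c` measurable; `S(z) = Σ_{n<N} D_{k+n}`,
`β_k = π f − (ν₂K^k) f`.  Then `E(S̄ − β_k)² − E[SE²] ∈ [0, (r^{k+N}(c − a))²]`. [ours] -/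
theorem crnLag_correction_replicas_mse_sub_SEsq_mem_Icc [Fact (Measurable w)] (hw0 : ∀ y, 0 < w y) {x₀ : Ω}
    (hmax : ∀ y, w y ≤ w x₀) [IsProbabilityMeasure (q.withDensity fun y => ENNReal.ofReal (w y))]
    (Khat : Kernel (Ω × Ω) (Ω × Ω)) [IsMarkovKernel Khat]
    (hK : ∀ z : Ω × Ω, Khat z = (q.prod (volume : Measure unitInterval)).map (fun p : Ω × unitInterval =>
      ((if (p.2 : ℝ) * w z.1 ≤ w p.1 then p.1 else z.1), (if (p.2 : ℝ) * w z.2 ≤ w p.1 then p.1 else z.2))))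
    (hlag : ν.map Prod.fst = (ν.map Prod.snd).bind (indepMH q w))
    {f : Ω → ℝ} (hf : Measurable f) {a c : ℝ} (ha : ∀ x, a ≤ f x) (hc : ∀ x, f x ≤ c) (k N : ℕ) (hR : 2 ≤ R)
    (hZm : ∀ j, Measurable (Z j))
    (hlaw : ∀ j < R, μ.map (Z j) = Kernel.trajMeasure (X := fun _ : ℕ => Ω × Ω) ν
      (fun n : ℕ => Khat.comap (fun h : (i : ↥(Finset.Iic n)) → Ω × Ω => h ⟨n, Finset.mem_Iic.2 le_rfl⟩)
        (measurable_pi_apply _)))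
    (hind : ∀ i < R, ∀ j < R, i ≠ j → IndepFun (Z i) (Z j) μ) :
    ∫ ω, (replicaMean (fun j ω => ∑ n ∈ range N, (f ((Z j ω (k + n)).1) - f ((Z j ω (k + n)).2))) R ω -
        (∫ x, f x ∂(q.withDensity fun y => ENNReal.ofReal (w y)) -
          ∫ y, f y ∂((fun m : Measure Ω => m.bind (indepMH q w))^[k] (ν.map Prod.snd)))) ^ 2 ∂μ -
      μ[replicaSEsq (fun j ω => ∑ n ∈ range N, (f ((Z j ω (k + n)).1) - f ((Z j ω (k + n)).2))) R] ∈
      Set.Icc 0 (((1 - (w x₀)⁻¹) ^ (k + N) * (c - a)) ^ 2) := by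
  rw [replicas_stat_sq_eq_SEsq_add hR (measurable_crnCorrectionSum hf k N) (abs_crnCorrectionSum_le ha hc k N) hZm hlaw hind,
    add_sub_cancel_left]
  have hb := crnLag_correction_bias_abs_le hw0 hmax Khat hK ν hlag hf ha hc k N
  refine ⟨sq_nonneg _, ?_⟩
  rw [← sq_abs]
  exact pow_le_pow_left₀ (abs_nonneg _) hb 2

/-- **THE DIAGNOSTIC'S ERROR BAR VANISHES GEOMETRICALLY IN THE LAG AND LIKE `1/R`**:
`E[SE²] ≤ [r^k(c − a)²W(2W − 1) + (r^{k+N}(c − a))²]/R` in the setting of `crnLag_correction_replicas_mse_sub_SEsq_mem_Icc`. [ours] -/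
theorem crnLag_correction_replicas_integral_SEsq_le [Fact (Measurable w)] (hw0 : ∀ y, 0 < w y) {x₀ : Ω}
    (hmax : ∀ y, w y ≤ w x₀) [IsProbabilityMeasure (q.withDensity fun y => ENNReal.ofReal (w y))]
    (Khat : Kernel (Ω × Ω) (Ω × Ω)) [IsMarkovKernel Khat]
    (hK : ∀ z : Ω × Ω, Khat z = (q.prod (volume : Measure unitInterval)).map (fun p : Ω × unitInterval =>
      ((if (p.2 : ℝ) * w z.1 ≤ w p.1 then p.1 else z.1), (if (p.2 : ℝ) * w z.2 ≤ w p.1 then p.1 else z.2))))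
    (hlag : ν.map Prod.fst = (ν.map Prod.snd).bind (indepMH q w))
    {f : Ω → ℝ} (hf : Measurable f) {a c : ℝ} (ha : ∀ x, a ≤ f x) (hc : ∀ x, f x ≤ c) (k N : ℕ) (hR : 2 ≤ R)
    (hZm : ∀ j, Measurable (Z j))
    (hlaw : ∀ j < R, μ.map (Z j) = Kernel.trajMeasure (X := fun _ : ℕ => Ω × Ω) ν
      (fun n : ℕ => Khat.comap (fun h : (i : ↥(Finset.Iic n)) → Ω × Ω => h ⟨n, Finset.mem_Iic.2 le_rfl⟩)
        (measurable_pi_apply _)))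
    (hind : ∀ i < R, ∀ j < R, i ≠ j → IndepFun (Z i) (Z j) μ) :
    μ[replicaSEsq (fun j ω => ∑ n ∈ range N, (f ((Z j ω (k + n)).1) - f ((Z j ω (k + n)).2))) R] ≤
      ((1 - (w x₀)⁻¹) ^ k * (c - a) ^ 2 * (w x₀ * (2 * w x₀ - 1)) + ((1 - (w x₀)⁻¹) ^ (k + N) * (c - a)) ^ 2) / R := by
  have hR0 : R ≠ 0 := by omega
  have hRpos : (0 : ℝ) < R := by exact_mod_cast Nat.pos_of_ne_zero hR0
  set θ := ∫ x, f x ∂(q.withDensity fun y => ENNReal.ofReal (w y)) -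
    ∫ y, f y ∂((fun m : Measure Ω => m.bind (indepMH q w))^[k] (ν.map Prod.snd)) with hθ
  set B := (1 - (w x₀)⁻¹) ^ k * (c - a) ^ 2 * (w x₀ * (2 * w x₀ - 1)) + ((1 - (w x₀)⁻¹) ^ (k + N) * (c - a)) ^ 2 with hB
  have hSm : Measurable fun z : ℕ → Ω × Ω => ∑ n ∈ range N, (f ((z (k + n)).1) - f ((z (k + n)).2)) :=
    measurable_crnCorrectionSum hf k N
  have hSb := abs_crnCorrectionSum_le ha hc k N (f := f)
  have hY2 : ∀ j < R, MemLp (fun ω => ∑ n ∈ range N, (f ((Z j ω (k + n)).1) - f ((Z j ω (k + n)).2))) 2 μ :=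
    fun j _ => memLp_stat_replica hSm hSb hZm j
  have hcov : ∀ i < R, ∀ j < R, i ≠ j →
      cov[fun ω => ∑ n ∈ range N, (f ((Z i ω (k + n)).1) - f ((Z i ω (k + n)).2)),
        fun ω => ∑ n ∈ range N, (f ((Z j ω (k + n)).1) - f ((Z j ω (k + n)).2)); μ] = 0 :=
    fun i hi j hj hij => ((hind i hi j hj hij).comp hSm hSm).covariance_eq_zero (hY2 i hi) (hY2 j hj)
  -- per replica: `Var(S_j) ≤ E(S_j − β_k)² ≤ B`, the second step transferred along the law to D1's bound
  have hvar : ∀ j ∈ range R, Var[fun ω => ∑ n ∈ range N, (f ((Z j ω (k + n)).1) - f ((Z j ω (k + n)).2)); μ] ≤ B := by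
    intro j hj
    have hj' := mem_range.1 hj
    have h1 := integral_sub_const_sq (hY2 j hj') θ
    have h2 : ∫ ω, (∑ n ∈ range N, (f ((Z j ω (k + n)).1) - f ((Z j ω (k + n)).2)) - θ) ^ 2 ∂μ ≤ B := by
      rw [integral_comp_eq_of_map_eq (hZm j) (hlaw j hj')
        (φ := fun z : ℕ → Ω × Ω => (∑ n ∈ range N, (f ((z (k + n)).1) - f ((z (k + n)).2)) - θ) ^ 2)
        ((hSm.sub measurable_const).pow_const 2)]
      exact crnLag_correction_sub_bias_sq_le hw0 hmax Khat hK ν hlag hf ha hc k N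
    nlinarith [sq_nonneg (μ[fun ω => ∑ n ∈ range N, (f ((Z j ω (k + n)).1) - f ((Z j ω (k + n)).2))] - θ)]
  rw [replicas_stat_integral_SEsq_eq hR hSm hSb hZm hlaw hind, variance_replicaMean hR0 hY2 hcov]
  calc (∑ j ∈ range R, Var[fun ω => ∑ n ∈ range N, (f ((Z j ω (k + n)).1) - f ((Z j ω (k + n)).2)); μ]) / (R : ℝ) ^ 2
      ≤ (∑ _j ∈ range R, B) / (R : ℝ) ^ 2 := div_le_div_of_nonneg_right (sum_le_sum hvar) (by positivity)
    _ = B / R := by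
        rw [sum_const, card_range, nsmul_eq_mul]
        field_simp

/-- **THE STOPPING RULE**: `P(|S̄ − β_k| ≥ s) ≤ (E[SE²] + (r^{k+N}(c − a))²)/s²` for `s > 0` — the unknown remaining burn-in bias
`β_k` lies in `[S̄ − s, S̄ + s]` except with that probability, in the setting of `crnLag_correction_replicas_mse_sub_SEsq_mem_Icc`.
[ours] -/
theorem crnLag_correction_replicas_chebyshev [Fact (Measurable w)] (hw0 : ∀ y, 0 < w y) {x₀ : Ω}
    (hmax : ∀ y, w y ≤ w x₀) [IsProbabilityMeasure (q.withDensity fun y => ENNReal.ofReal (w y))]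
    (Khat : Kernel (Ω × Ω) (Ω × Ω)) [IsMarkovKernel Khat]
    (hK : ∀ z : Ω × Ω, Khat z = (q.prod (volume : Measure unitInterval)).map (fun p : Ω × unitInterval =>
      ((if (p.2 : ℝ) * w z.1 ≤ w p.1 then p.1 else z.1), (if (p.2 : ℝ) * w z.2 ≤ w p.1 then p.1 else z.2))))
    (hlag : ν.map Prod.fst = (ν.map Prod.snd).bind (indepMH q w))
    {f : Ω → ℝ} (hf : Measurable f) {a c : ℝ} (ha : ∀ x, a ≤ f x) (hc : ∀ x, f x ≤ c) (k N : ℕ) (hR : 2 ≤ R)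
    (hZm : ∀ j, Measurable (Z j))
    (hlaw : ∀ j < R, μ.map (Z j) = Kernel.trajMeasure (X := fun _ : ℕ => Ω × Ω) ν
      (fun n : ℕ => Khat.comap (fun h : (i : ↥(Finset.Iic n)) → Ω × Ω => h ⟨n, Finset.mem_Iic.2 le_rfl⟩)
        (measurable_pi_apply _)))
    (hind : ∀ i < R, ∀ j < R, i ≠ j → IndepFun (Z i) (Z j) μ) {s : ℝ} (hs : 0 < s) :
    μ.real {ω | s ≤ |replicaMean (fun j ω => ∑ n ∈ range N, (f ((Z j ω (k + n)).1) - f ((Z j ω (k + n)).2))) R ω -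
        (∫ x, f x ∂(q.withDensity fun y => ENNReal.ofReal (w y)) -
          ∫ y, f y ∂((fun m : Measure Ω => m.bind (indepMH q w))^[k] (ν.map Prod.snd)))|} ≤
      (μ[replicaSEsq (fun j ω => ∑ n ∈ range N, (f ((Z j ω (k + n)).1) - f ((Z j ω (k + n)).2))) R] +
        ((1 - (w x₀)⁻¹) ^ (k + N) * (c - a)) ^ 2) / s ^ 2 := by
  have hcheb := replicas_stat_chebyshev hR (measurable_crnCorrectionSum hf k N) (abs_crnCorrectionSum_le ha hc k N) hZm hlaw
    hind (∫ x, f x ∂(q.withDensity fun y => ENNReal.ofReal (w y)) -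
      ∫ y, f y ∂((fun m : Measure Ω => m.bind (indepMH q w))^[k] (ν.map Prod.snd))) hs
  have hb := crnLag_correction_bias_abs_le hw0 hmax Khat hK ν hlag hf ha hc k N
  have hsq : (∫ z, (∑ n ∈ range N, (f ((z (k + n)).1) - f ((z (k + n)).2)))
        ∂(Kernel.trajMeasure (X := fun _ : ℕ => Ω × Ω) ν
          (fun n : ℕ => Khat.comap (fun h : (i : ↥(Finset.Iic n)) → Ω × Ω => h ⟨n, Finset.mem_Iic.2 le_rfl⟩)
            (measurable_pi_apply _))) -
      (∫ x, f x ∂(q.withDensity fun y => ENNReal.ofReal (w y)) -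
        ∫ y, f y ∂((fun m : Measure Ω => m.bind (indepMH q w))^[k] (ν.map Prod.snd)))) ^ 2 ≤
      ((1 - (w x₀)⁻¹) ^ (k + N) * (c - a)) ^ 2 := by
    rw [← sq_abs]
    exact pow_le_pow_left₀ (abs_nonneg _) hb 2
  refine hcheb.trans (div_le_div_of_nonneg_right ?_ (sq_nonneg s))
  linarith

end Replicas

end Summit.Ventures.LatticeQCDFlow.Exactness

end
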